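import Summits.HubbardSuperconductivity.HubbardSuperconductivity.Theorems.NodalDiracTwistDiskTrivialHolonomyGrid
import Literature.MathematicalPhysics.QuantumLattice.SectorSpectrum

/-!
# Route `NodalDiracTwist` — crux `NodalDiracWeakCoupling`, line `birth`: Möbius sign, part 2 (real sections)

Helper file (`--supports stmt-HubbardSuperconductivity-10370`) for the lead's assembly stub
`stub_moebiusAbstract`. Abstract setting of the landed `re_prod_cyclicOverlap_pos`: a sector
`K ≤ (ι → ℂ)`, a matrix `A` (one member `H φ` of the family), sector ground states in the literal
shape `χ ∈ K ∧ χ ≠ 0 ∧ A *ᵥ χ = minEnergyOn A K • χ`, and an antiunitary operation `T`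
(`T (c v) = c̄ T v`, `⟨T u, T v⟩ = conj ⟨u, v⟩`) preserving `K` and commuting with `A`. Contents:
* `T`-bookkeeping: `T χ ≠ 0`, overlaps of `T`-real vectors are real, matrix elements
  `⟨e, A e'⟩` between `T`-real vectors are real;
* `groundState_unique_of_cone`: a CONE inequality at a point (every unit sector vector orthogonal
  to a ground state has energy `≥ E + m'`, `m' > 0`) makes the sector ground state unique up to
  scalars (Gram–Schmidt inside the ground eigenspace);
* `exists_real_unit_groundState`: at a point of uniqueness there is a `T`-REAL UNIT ground state
  (`T χ = z χ`, `|z| = 1`, rescale by `√z`) — the pointwise form of Step 0 of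
  `re_prod_cyclicOverlap_pos`;
* `im_pencil_entry_eq_zero`: for `T`-real unit `e, e'` the first-order matrix elements
  `⟨e, V μ e'⟩` of a family `H` commuting with `T` are real (Taylor bound + reality of
  `⟨e, H φ e'⟩` for every `φ`, an `ε`-argument).
Sources: Hatsugai, J. Phys. Soc. Jpn. 75 (2006) 123601 (antiunitary symmetry, real sections);
Wigner (1932). No definitions.
-/

-- the mandated namespace `Summit.<Summit>.<Problem>.Theorems` repeats `HubbardSuperconductivity`
-- (single-problem summit, D-0017), which the `dupNamespace` linter flags on every declaration
set_option linter.dupNamespace false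

namespace Summit.HubbardSuperconductivity.HubbardSuperconductivity.Theorems.NodalDiracTwist

open Matrix Complex
open scoped ComplexOrder

variable {ι : Type*} [Fintype ι]

/-! ### `T`-bookkeeping -/

/-- An operation with `⟨T u, T v⟩ = conj ⟨u, v⟩` maps nonzero vectors to nonzero vectors.
[folklore] -/
theorem antiunitary_ne_zero {T : (ι → ℂ) → (ι → ℂ)}
    (hTd : ∀ u v : ι → ℂ, star (T u) ⬝ᵥ T v = star (star u ⬝ᵥ v)) {χ : ι → ℂ} (hχ : χ ≠ 0) :
    T χ ≠ 0 := by
  intro hT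
  apply hχ
  have h := hTd χ χ
  rw [hT, star_zero, zero_dotProduct] at h
  exact dotProduct_star_self_eq_zero.1 (star_eq_zero.1 h.symm)

/-- Overlaps of `T`-real vectors are real: `⟨u, v⟩ = conj ⟨u, v⟩` when `T u = u`, `T v = v`.
Hatsugai, J. Phys. Soc. Jpn. 75 (2006) 123601. [folklore] -/
theorem star_dotProduct_ofReal_of_real {T : (ι → ℂ) → (ι → ℂ)}
    (hTd : ∀ u v : ι → ℂ, star (T u) ⬝ᵥ T v = star (star u ⬝ᵥ v)) {u v : ι → ℂ}
    (hu : T u = u) (hv : T v = v) : star u ⬝ᵥ v = (((star u ⬝ᵥ v).re : ℝ) : ℂ) := by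
  have h := hTd u v
  rw [hu, hv, Complex.star_def] at h
  exact (Complex.conj_eq_iff_re.1 h.symm).symm

/-- Matrix elements between `T`-real vectors of a matrix commuting with `T` are real:
`Im ⟨e, A e'⟩ = 0`. [folklore] -/
theorem im_star_dotProduct_mulVec_eq_zero {T : (ι → ℂ) → (ι → ℂ)} {A : Matrix ι ι ℂ}
    (hTA : ∀ v : ι → ℂ, T (A *ᵥ v) = A *ᵥ T v)
    (hTd : ∀ u v : ι → ℂ, star (T u) ⬝ᵥ T v = star (star u ⬝ᵥ v)) {e e' : ι → ℂ}
    (he : T e = e) (he' : T e' = e') : (star e ⬝ᵥ (A *ᵥ e')).im = 0 := by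
  have h := hTd e (A *ᵥ e')
  rw [he, hTA, he', Complex.star_def] at h
  exact Complex.conj_eq_iff_im.1 h.symm

/-! ### Sector ground states: scaling, `T`, uniqueness from a cone, real unit sections -/

section GroundStates

variable (K : Submodule ℂ (ι → ℂ)) (A : Matrix ι ι ℂ)

/-- A nonzero scalar multiple of a sector ground state is a sector ground state. [folklore] -/
theorem groundState_smul {χ : ι → ℂ} {c : ℂ} (hc : c ≠ 0)
    (h : χ ∈ K ∧ χ ≠ 0 ∧ A *ᵥ χ = ((A.minEnergyOn K : ℝ) : ℂ) • χ) :
    c • χ ∈ K ∧ c • χ ≠ 0 ∧ A *ᵥ (c • χ) = ((A.minEnergyOn K : ℝ) : ℂ) • (c • χ) :=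
  ⟨K.smul_mem c h.1, smul_ne_zero hc h.2.1, by rw [mulVec_smul, h.2.2, smul_comm]⟩

/-- `T` maps sector ground states to sector ground states (the energy is real).
Hatsugai, J. Phys. Soc. Jpn. 75 (2006) 123601. [folklore] -/
theorem groundState_antiunitary {T : (ι → ℂ) → (ι → ℂ)}
    (hTs : ∀ (c : ℂ) (v : ι → ℂ), T (c • v) = star c • T v) (hTK : ∀ v ∈ K, T v ∈ K)
    (hTA : ∀ v : ι → ℂ, T (A *ᵥ v) = A *ᵥ T v)
    (hTd : ∀ u v : ι → ℂ, star (T u) ⬝ᵥ T v = star (star u ⬝ᵥ v)) {χ : ι → ℂ}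
    (h : χ ∈ K ∧ χ ≠ 0 ∧ A *ᵥ χ = ((A.minEnergyOn K : ℝ) : ℂ) • χ) :
    T χ ∈ K ∧ T χ ≠ 0 ∧ A *ᵥ T χ = ((A.minEnergyOn K : ℝ) : ℂ) • T χ := by
  refine ⟨hTK χ h.1, antiunitary_ne_zero hTd h.2.1, ?_⟩
  rw [← hTA, h.2.2, hTs, Complex.star_def, Complex.conj_ofReal]

/-- **Uniqueness of the sector ground state from a cone inequality.** If every unit vector of
`K` orthogonal to a ground state `ψ` has energy at least `minEnergyOn A K + m'` with `m' > 0`,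
then any two sector ground states are parallel: otherwise Gram–Schmidt inside the ground
eigenspace produces a unit ground state orthogonal to `ψ`, of energy exactly `minEnergyOn A K`.
[folklore] -/
theorem groundState_unique_of_cone {m' : ℝ} (hm' : 0 < m')
    (hc : ∀ ψ χ : ι → ℂ, (ψ ∈ K ∧ ψ ≠ 0 ∧ A *ᵥ ψ = ((A.minEnergyOn K : ℝ) : ℂ) • ψ) →
      χ ∈ K → star ψ ⬝ᵥ χ = 0 → star χ ⬝ᵥ χ = 1 →
        A.minEnergyOn K + m' ≤ (star χ ⬝ᵥ (A *ᵥ χ)).re)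
    {χ₁ χ₂ : ι → ℂ} (h₁ : χ₁ ∈ K ∧ χ₁ ≠ 0 ∧ A *ᵥ χ₁ = ((A.minEnergyOn K : ℝ) : ℂ) • χ₁)
    (h₂ : χ₂ ∈ K ∧ χ₂ ≠ 0 ∧ A *ᵥ χ₂ = ((A.minEnergyOn K : ℝ) : ℂ) • χ₂) :
    ∃ z : ℂ, χ₂ = z • χ₁ := by
  obtain ⟨hmem₁, hne₁, heig₁⟩ := h₁
  obtain ⟨hmem₂, _, heig₂⟩ := h₂
  set w := χ₂ - ((star χ₁ ⬝ᵥ χ₂) / (star χ₁ ⬝ᵥ χ₁)) • χ₁ with hw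
  by_cases hpar : w = 0
  · exact ⟨(star χ₁ ⬝ᵥ χ₂) / (star χ₁ ⬝ᵥ χ₁), sub_eq_zero.1 hpar⟩
  · exfalso
    have hne : star χ₁ ⬝ᵥ χ₁ ≠ 0 := fun h => hne₁ (dotProduct_star_self_eq_zero.1 h)
    have hwK : w ∈ K := Submodule.sub_mem _ hmem₂ (Submodule.smul_mem _ _ hmem₁)
    have hweig : A *ᵥ w = ((A.minEnergyOn K : ℝ) : ℂ) • w := by
      rw [hw, mulVec_sub, mulVec_smul, heig₁, heig₂, smul_sub,
        smul_comm ((star χ₁ ⬝ᵥ χ₂) / (star χ₁ ⬝ᵥ χ₁))]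
    have hworth : star χ₁ ⬝ᵥ w = 0 := by
      rw [hw, dotProduct_sub, dotProduct_smul, smul_eq_mul, div_mul_cancel₀ _ hne, sub_self]
    obtain ⟨c, hc0, hc1⟩ := Literature.MathematicalPhysics.QuantumLattice.exists_smul_unit hpar
    have hgs := groundState_smul K A hc0 ⟨hwK, hpar, hweig⟩
    have horth : star χ₁ ⬝ᵥ (c • w) = 0 := by rw [dotProduct_smul, hworth, smul_zero]
    have h := hc χ₁ (c • w) ⟨hmem₁, hne₁, heig₁⟩ hgs.1 horth hc1
    rw [hgs.2.2, dotProduct_smul, hc1, smul_eq_mul, mul_one, Complex.ofReal_re] at h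
    linarith

/-- **A `T`-real unit ground state exists at a point of uniqueness.** If sector ground states of
`A` exist and are unique up to scalars, and `T` is an antiunitary operation preserving `K` and
commuting with `A`, then there is a unit ground state `s` with `T s = s` (`T χ = z χ` with
`|z| = 1`; rescale by a square root of `z`). Pointwise form of Step 0 of
`re_prod_cyclicOverlap_pos`. Hatsugai, J. Phys. Soc. Jpn. 75 (2006) 123601. [folklore] -/
theorem exists_real_unit_groundState {T : (ι → ℂ) → (ι → ℂ)}
    (hTs : ∀ (c : ℂ) (v : ι → ℂ), T (c • v) = star c • T v) (hTK : ∀ v ∈ K, T v ∈ K)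
    (hTA : ∀ v : ι → ℂ, T (A *ᵥ v) = A *ᵥ T v)
    (hTd : ∀ u v : ι → ℂ, star (T u) ⬝ᵥ T v = star (star u ⬝ᵥ v))
    (hex : ∃ v ∈ K, v ≠ 0 ∧ A *ᵥ v = ((A.minEnergyOn K : ℝ) : ℂ) • v)
    (huniq : ∀ χ₁ χ₂ : ι → ℂ, (χ₁ ∈ K ∧ χ₁ ≠ 0 ∧ A *ᵥ χ₁ = ((A.minEnergyOn K : ℝ) : ℂ) • χ₁) →
      (χ₂ ∈ K ∧ χ₂ ≠ 0 ∧ A *ᵥ χ₂ = ((A.minEnergyOn K : ℝ) : ℂ) • χ₂) → ∃ z : ℂ, χ₂ = z • χ₁) :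
    ∃ s : ι → ℂ, (s ∈ K ∧ s ≠ 0 ∧ A *ᵥ s = ((A.minEnergyOn K : ℝ) : ℂ) • s) ∧
      star s ⬝ᵥ s = 1 ∧ T s = s := by
  obtain ⟨v, hvK, hv0, hv⟩ := hex
  obtain ⟨c, hc0, hc1⟩ := Literature.MathematicalPhysics.QuantumLattice.exists_smul_unit hv0
  have hχ := groundState_smul K A hc0 ⟨hvK, hv0, hv⟩
  obtain ⟨z, hz⟩ := huniq (c • v) (T (c • v)) hχ (groundState_antiunitary K A hTs hTK hTA hTd hχ)
  have hT1 : star (T (c • v)) ⬝ᵥ T (c • v) = 1 := by rw [hTd, hc1, star_one]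
  rw [hz] at hT1
  have hz1 : ‖z‖ = 1 := norm_eq_one_of_unit_smul hc1 hT1
  obtain ⟨w, hw⟩ := IsAlgClosed.exists_pow_nat_eq z two_pos
  have hw1 : ‖w‖ = 1 := by
    have h := congrArg norm hw
    rw [norm_pow, hz1] at h
    exact (pow_eq_one_iff_of_nonneg (norm_nonneg w) two_ne_zero).1 h
  have hw0 : w ≠ 0 := fun h => by
    rw [h, norm_zero] at hw1
    exact zero_ne_one hw1
  refine ⟨w • (c • v), groundState_smul K A hw0 hχ, ?_, ?_⟩
  · rw [star_smul_dotProduct_smul, hc1, hw1, one_pow, Complex.ofReal_one, one_mul]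
  · rw [hTs, hz, smul_smul, ← hw]
    congr 1
    calc star w * w ^ 2 = (starRingEnd ℂ w * w) * w := by rw [Complex.star_def]; ring
      _ = w := by rw [Complex.conj_mul', hw1, Complex.ofReal_one, one_pow, one_mul]

end GroundStates

/-! ### Reality of the first-order matrix elements -/

/-- **The first-order matrix elements between `T`-real vectors are real.** Let the family `H`
commute with the antiunitary `T` (so `⟨e, H φ e'⟩ ∈ ℝ` for `T`-real unit `e, e'` and every `φ`)
and let `V 0, V 1` satisfy the first-order Taylor bound at `p` for the sesquilinear form on unit
vectors. Then `Im ⟨e, V μ e'⟩ = 0`: along `y = δ e_μ` the bound reads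
`|⟨e, (H(p+y) - H p) e'⟩ - δ ⟨e, V μ e'⟩| ≤ ε δ` with a real first term, so
`|Im ⟨e, V μ e'⟩| ≤ ε` for every `ε > 0`. [folklore] -/
theorem im_pencil_entry_eq_zero (H : (Fin 2 → ℝ) → Matrix ι ι ℂ) (p : Fin 2 → ℝ)
    (V : Fin 2 → Matrix ι ι ℂ) {T : (ι → ℂ) → (ι → ℂ)}
    (hTH : ∀ (φ : Fin 2 → ℝ) (v : ι → ℂ), T (H φ *ᵥ v) = H φ *ᵥ T v)
    (hTd : ∀ u v : ι → ℂ, star (T u) ⬝ᵥ T v = star (star u ⬝ᵥ v))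
    (hTaylor : ∀ ε : ℝ, 0 < ε → ∃ δ : ℝ, 0 < δ ∧ ∀ y : Fin 2 → ℝ,
      Real.sqrt (y 0 ^ 2 + y 1 ^ 2) ≤ δ → ∀ x w : ι → ℂ, star x ⬝ᵥ x = 1 → star w ⬝ᵥ w = 1 →
        ‖star x ⬝ᵥ ((H (fun ν => p ν + y ν) - H p -
            (((y 0 : ℝ) : ℂ) • V 0 + ((y 1 : ℝ) : ℂ) • V 1)) *ᵥ w)‖ ≤
          ε * Real.sqrt (y 0 ^ 2 + y 1 ^ 2))
    {e e' : ι → ℂ} (he : T e = e) (he' : T e' = e') (he1 : star e ⬝ᵥ e = 1)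
    (he'1 : star e' ⬝ᵥ e' = 1) (μ : Fin 2) :
    (star e ⬝ᵥ (V μ *ᵥ e')).im = 0 := by
  -- `|Im ⟨e, V μ e'⟩| ≤ ε` for every `ε > 0`
  have key : ∀ ε : ℝ, 0 < ε → |(star e ⬝ᵥ (V μ *ᵥ e')).im| ≤ ε := by
    intro ε hε
    obtain ⟨δ, hδ0, hδ⟩ := hTaylor ε hε
    set y : Fin 2 → ℝ := fun ν => if ν = μ then δ else 0 with hy
    have hnorm : Real.sqrt (y 0 ^ 2 + y 1 ^ 2) = δ := by
      have : y 0 ^ 2 + y 1 ^ 2 = δ ^ 2 := by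
        fin_cases μ <;> simp [hy]
      rw [this, Real.sqrt_sq hδ0.le]
    have hlin : ((y 0 : ℝ) : ℂ) • V 0 + ((y 1 : ℝ) : ℂ) • V 1 = ((δ : ℝ) : ℂ) • V μ := by
      fin_cases μ <;> simp [hy]
    have h := hδ y hnorm.le e e' he1 he'1
    rw [hnorm, hlin, sub_mulVec, sub_mulVec, dotProduct_sub, dotProduct_sub, smul_mulVec,
      dotProduct_smul, smul_eq_mul] at h
    -- the zeroth-order terms are real
    have him : (star e ⬝ᵥ (H (fun ν => p ν + y ν) *ᵥ e') - star e ⬝ᵥ (H p *ᵥ e') -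
        ((δ : ℝ) : ℂ) * (star e ⬝ᵥ (V μ *ᵥ e'))).im = -(δ * (star e ⬝ᵥ (V μ *ᵥ e')).im) := by
      rw [Complex.sub_im, Complex.sub_im, im_star_dotProduct_mulVec_eq_zero (hTH _) hTd he he',
        im_star_dotProduct_mulVec_eq_zero (hTH _) hTd he he', Complex.im_ofReal_mul]
      ring
    have h2 := (Complex.abs_im_le_norm _).trans h
    rw [him, abs_neg, abs_mul, abs_of_pos hδ0] at h2
    exact le_of_mul_le_mul_left (by linarith) hδ0
  -- hence it vanishes
  by_contra hne
  have hpos : 0 < |(star e ⬝ᵥ (V μ *ᵥ e')).im| := abs_pos.2 hne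
  have := key (|(star e ⬝ᵥ (V μ *ᵥ e')).im| / 2) (by positivity)
  linarith

end Summit.HubbardSuperconductivity.HubbardSuperconductivity.Theorems.NodalDiracTwist
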